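import Literature.Geometry.Riemannian.ShrinkerMinimumPrincipleCalculus
import HarnessLib

/-!
# The cut-off family of the elliptic Hamilton–Ivey estimate on three-dimensional shrinkers

In the localised maximum principle for the Hamilton–Ivey quantity on a complete three-dimensional
gradient shrinking Ricci soliton (potential `f`, `Δ_f f = 3/2 - f`, `|∇f|² = f - R ≤ f`) one
multiplies by `Θ(f)` with `Θ(t) = ψ(t / (2A))`, `ψ` the `C²` cut-off of Zhang's localised minimum
principle (`Zhang2009.exists_cutoffSq`: `ψ = 1` on `(-∞, ½]`, `ψ = 0` on `[1, ∞)`, `ψ` antitone,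
`0 ≤ ψ`, `ψ' ≤ 0`, and on `[0, 1]` the bounds `|ψ'|, |ψ''| ≤ K₀`, `ψ'² ≤ K₀ ψ`). At the maximum
point the cut-off enters only through
`E = -(Θ''(t) g + Θ'(t) (3/2 - t)) + 2 Θ'(t)² g / Θ(t)`, `t = f(x)`, `g = |∇f|²(x) ∈ [0, t]`,
and `exists_cutoff_family` records `Θ = 1` on `t ≤ A`, `Θ = 0` on `t ≥ 2A`, `0 ≤ Θ ≤ 1` and the
uniform bound `E ≤ K / A` (`A ≥ 3/2`, `K = 2K₀`). With `s = t/(2A) ∈ [0, 1)` (as `Θ(t) > 0`) and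
`g ≤ t < 2A`:
* `-Θ''(t) g = -ψ''(s) g / (4A²) ≤ K₀ · 2A / (4A²) = K₀ / (2A)`;
* `-Θ'(t) (3/2 - t) ≤ 0`: for `t ≥ 3/2` both `Θ'(t) = ψ'(s)/(2A)` and `3/2 - t` are `≤ 0`, for
  `t < 3/2 ≤ A` one has `s < ½`, where `ψ` is locally constant, so `ψ'(s) = 0`;
* `2 Θ'(t)² g / Θ(t) = 2 ψ'(s)² g / (4A² ψ(s)) ≤ 2 K₀ ψ(s) · 2A / (4A² ψ(s)) = K₀ / A`.

Everything is proved; no definitions, no named facts.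

## References

* Z.-H. Zhang, *On the completeness of gradient Ricci solitons*, Proc. AMS 137 (2009) 2755–2759,
  proof of Thm. 1.3, Step 1 (the cut-off `ψ(d/A)` of the localised minimum principle). [Zhang2009]
-/

noncomputable section

open Set Filter
open scoped Topology

namespace Literature.Geometry.Riemannian.HamiltonIvey

/-- **Cut-off family of the localised Hamilton–Ivey estimate** (the cut-off of Zhang 2009, proof of
Thm. 1.3, Step 1, rescaled to the potential: `Θ_A(t) = ψ(t/(2A))`). There is `K ≥ 0` such that for
every `A ≥ 3/2` there are `Θ, Θ', Θ''` (`Θ'` the derivative of `Θ`, `Θ''` that of `Θ'`) with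
`Θ = 1` on `(-∞, A]`, `Θ = 0` on `[2A, ∞)`, `0 ≤ Θ ≤ 1`, and, whenever `Θ(t) > 0` and
`0 ≤ g ≤ t`, `-(Θ''(t) g + Θ'(t) (3/2 - t)) + 2 Θ'(t)² g / Θ(t) ≤ K / A`.
[cite: Zhang2009, proof of Thm. 1.3, Step 1] -/
theorem exists_cutoff_family : ∃ K : ℝ, 0 ≤ K ∧ ∀ A : ℝ, 3 / 2 ≤ A →
    ∃ Θ Θ' Θ'' : ℝ → ℝ, (∀ t, HasDerivAt Θ (Θ' t) t) ∧ (∀ t, HasDerivAt Θ' (Θ'' t) t) ∧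
      (∀ t, t ≤ A → Θ t = 1) ∧ (∀ t, 2 * A ≤ t → Θ t = 0) ∧ (∀ t, 0 ≤ Θ t ∧ Θ t ≤ 1) ∧
      (∀ t g : ℝ, 0 < Θ t → 0 ≤ g → g ≤ t →
        -(Θ'' t * g + Θ' t * (3 / 2 - t)) + 2 * (Θ' t) ^ 2 * g / Θ t ≤ K / A) := by
  obtain ⟨ψ, ψ', ψ'', K₀, hψ, hψ', hanti, hone, hzero, hnn, hψ'le, hK₀, -, hb2, hb3⟩ :=
    Zhang2009.exists_cutoffSq
  -- `ψ'` vanishes on `(-∞, ½)`, where `ψ` is locally constant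
  have hψ'zero : ∀ s : ℝ, s < 1 / 2 → ψ' s = 0 := fun s hs ↦ by
    have hev : ψ =ᶠ[𝓝 s] fun _ ↦ (1 : ℝ) :=
      (eventually_lt_nhds hs).mono fun y hy ↦ hone y hy.le
    exact (hψ s).unique ((hasDerivAt_const s (1 : ℝ)).congr_of_eventuallyEq hev)
  have hle1 : ∀ s, ψ s ≤ 1 := fun s ↦
    (hanti (min_le_left s (1 / 2))).trans_eq (hone _ (min_le_right _ _))
  refine ⟨2 * K₀, by positivity, fun A hA ↦ ?_⟩
  have hA0 : 0 < A := by linarith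
  have h2A : 0 < 2 * A := by linarith
  have hd : ∀ t : ℝ, HasDerivAt (fun t : ℝ ↦ t / (2 * A)) (1 / (2 * A)) t := fun t ↦
    (hasDerivAt_id' t).div_const (2 * A)
  refine ⟨fun t ↦ ψ (t / (2 * A)), fun t ↦ ψ' (t / (2 * A)) / (2 * A),
    fun t ↦ ψ'' (t / (2 * A)) / (2 * A) / (2 * A), fun t ↦ ?_, fun t ↦ ?_, fun t ht ↦ ?_,
    fun t ht ↦ ?_, fun t ↦ ⟨hnn _, hle1 _⟩, fun t g hpos hg0 hgt ↦ ?_⟩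
  · exact ((hψ _).comp t (hd t)).congr_deriv (by ring)
  · exact (((hψ' _).comp t (hd t)).div_const (2 * A)).congr_deriv (by ring)
  · exact hone _ (by rw [div_le_iff₀ h2A]; linarith)
  · exact hzero _ ((one_le_div h2A).2 ht)
  · -- the estimate at a point with `Θ t > 0` and `0 ≤ g ≤ t`
    set s : ℝ := t / (2 * A) with hs
    have ht0 : 0 ≤ t := hg0.trans hgt
    have hs0 : 0 ≤ s := div_nonneg ht0 h2A.le
    have hs1 : s < 1 := not_le.mp fun h ↦ hpos.ne' (hzero s h)
    have ht2A : t < 2 * A := (div_lt_one h2A).1 hs1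
    have hg2A : g ≤ 2 * A := by linarith
    have hsI : s ∈ Icc (0 : ℝ) 1 := ⟨hs0, hs1.le⟩
    -- (i) the second-derivative term
    have h1 : -(ψ'' s / (2 * A) / (2 * A) * g) ≤ K₀ / (2 * A) := by
      have hm : -ψ'' s ≤ K₀ := (neg_le_abs _).trans (hb2 s hsI)
      have key : -ψ'' s * g ≤ K₀ * (2 * A) :=
        (mul_le_mul_of_nonneg_right hm hg0).trans (mul_le_mul_of_nonneg_left hg2A hK₀)
      rw [show -(ψ'' s / (2 * A) / (2 * A) * g) = -ψ'' s * g / (2 * A) / (2 * A) by ring]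
      refine div_le_div_of_nonneg_right ?_ h2A.le
      rwa [div_le_iff₀ h2A]
    -- (ii) the drift term has a sign
    have h2 : 0 ≤ ψ' s / (2 * A) * (3 / 2 - t) := by
      rcases lt_or_ge t (3 / 2) with h | h
      · have hs2 : s < 1 / 2 := by rw [hs, div_lt_iff₀ h2A]; linarith
        rw [hψ'zero s hs2, zero_div, zero_mul]
      · exact mul_nonneg_of_nonpos_of_nonpos
          (div_nonpos_of_nonpos_of_nonneg (hψ'le s) h2A.le) (by linarith)
    -- (iii) the gradient term, by the quotient bound `ψ'² ≤ K₀ ψ`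
    have h3 : 2 * (ψ' s / (2 * A)) ^ 2 * g / ψ s ≤ K₀ / A := by
      have key : ψ' s ^ 2 * g ≤ K₀ * ψ s * (2 * A) :=
        (mul_le_mul_of_nonneg_right (hb3 s hsI) hg0).trans
          (mul_le_mul_of_nonneg_left hg2A (mul_nonneg hK₀ (hnn s)))
      rw [div_le_iff₀ hpos,
        show 2 * (ψ' s / (2 * A)) ^ 2 * g = ψ' s ^ 2 * g / (2 * A * A) by ring,
        div_le_iff₀ (by positivity)]
      calc ψ' s ^ 2 * g ≤ K₀ * ψ s * (2 * A) := key
        _ = K₀ / A * ψ s * (2 * A * A) := by field_simp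
    have h4 : K₀ / (2 * A) ≤ K₀ / A := div_le_div_of_nonneg_left hK₀ hA0 (by linarith)
    have h5 : 2 * K₀ / A = 2 * (K₀ / A) := by ring
    linarith

end Literature.Geometry.Riemannian.HamiltonIvey

end
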